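import Summits.BirchSwinnertonDyer.BirchSwinnertonDyer.Theorems.ResidualThetaTransportAtTwoResidualSignedLambdaLowerCMAtTwoDeepHalfAwayTwoAssembly
import Summits.BirchSwinnertonDyer.BirchSwinnertonDyer.Theorems.ResidualThetaTransportAtTwoResidualSignedLambdaLowerCMAtTwoDeepHalfAwayTwoOrthogonal
import Summits.BirchSwinnertonDyer.BirchSwinnertonDyer.Theorems.ResidualThetaTransportAtTwoResidualSignedLambdaLowerCMAtTwoDeepHalfAwayTwoTransfer
import HarnessLib

/-!
# S4₀ ASSEMBLED modulo the two tower compatibilities: from `χ : PAway` with the text's hypothesis `(H₀)` to `x ∈ 𝐇¹_Γ(T_ρ)` with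
# `locdS x = χ` (pins as hypotheses; `a = 1`)

Route `ResidualThetaTransportAtTwo` (RTT), crux RSL_g `ResidualSignedLambdaLowerCMAtTwo` (stmt-BirchSwinnertonDyer-22608), stub S4₀ `stub_deepHalfAwayTwo`
(v3b); seat `prover-bsd-wall-tp2-p2x` g19 (`--supports 22608 --as helper`, closes nothing). THEOREMS ONLY (no definition, no named fact, no instance,
no notation, no `sorry`). BSD is not proved by any of this; RSL_g is not proved here.

WHAT. **`exists_iwasawaH1_locdS_eq_of_towerCompat`**: given the pin data of `AwayPins` as hypotheses (`locdS`, its value pin `hlocdS`), a non-degenerate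
self-dual tower `ePk`, `κ` cyclotomic, `S₀ ∌ 2` outside which `ρ` is unramified, a place `v ∋ 2`, a character `χ : PAway S κ ρ S₀` satisfying the S4₀
hypothesis `(H₀) ∀ s ∈ selRelSubgroup, locKer v s = 0 → ∑ w, ∑ᶠ c, χ w c (locAway s w c) = 0`, AND the two TOWER COMPATIBILITIES of the
character-built local classes — (T1) along `[2] : A_ρ[2^{k+1}] → A_ρ[2^k]` and (T2) along Kato's trace `Γ_{n+1} ≤ Γ_n` (both quantified over ANY data
`(b, t)` with the defining properties of `AwayCharacterReadback.exists_local_of_characters`, so that they are separate lemmas) — there is `x ∈ I.H` with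
`locdS x = χ`. Chain: `exists_local_of_characters` (p701888) per `(n ≥ n_w, k, w)` ↦ the (α)-family; `hT` := `AwayOrthogonal.sum_localTatePairingZMod_eq_zero_of_awayHyp`
(p703289); `htpow`/`htsum` := (T1)/(T2) through p697362 §2/§3; `x` := p697362 `DeepHalfAssemblyAway.exists_iwasawaH1_prescribed_of_levelwise_orthogonal`;
`locdS x = χ` := `AwayTransfer.locdS_eq_of_prescribed` (p702990). What remains for the stub BY NAME: (T1), (T2) (announced files `…AwayTowerPow`, `…AwayTowerCores`)
and the pins' `htower`/`hnondeg`/`hρ`/`CompactSpace 𝒪` (w2's `…StubDeepHalfAtTwoStrictPins`).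

References: [Kato2004Asterisque] §12.2, §13.8; [MilneADT2006] I Thm. 4.10, I §6; [NeukirchSchmidtWingberg2008] I §5–§6; [PerrinRiou1994Invent] §3.6.1;
[GreenbergVatsal2000] §2 Prop. 2.4.
-/

set_option autoImplicit false
-- the Theorems namespace of this sub repeats the summit name by design (D-0017 nested layout)
set_option linter.dupNamespace false

noncomputable section

open scoped Classical

namespace Summit.BirchSwinnertonDyer.BirchSwinnertonDyer.Theorems

namespace ThetaTransport.AwayAssembly

open CategoryTheory Function Field NumberField IsDedekindDomain
  Literature.NumberTheory.EllipticCurves Literature.NumberTheory.EllipticCurves.CyclotomicLayer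
  Literature.NumberTheory.EllipticCurves.GreenbergSelmer Literature.NumberTheory.EllipticCurves.GreenbergVatsal2000
  Literature.NumberTheory.GaloisRepresentations Literature.NumberTheory.GaloisRepresentations.DiscreteGaloisModule
  Literature.NumberTheory.GaloisCohomology Literature.NumberTheory.EllipticCurves.Kato2004 ZpExtension
  Summit.BirchSwinnertonDyer.BirchSwinnertonDyer.Theorems.OnePair
open ThetaTransport.AwayCharacterReadback ThetaTransport.AwayOrthogonal ThetaTransport.AwayTransfer ThetaTransport.DeepHalfAssemblyAway

-- the `ρ`-coefficient coinduced modules and their Tate duals make elaboration of these statements expensive (cf. p694426/p697362)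
set_option maxHeartbeats 3200000

variable (S : Set (PadicAlgCl 2)) (ρ : FramedGaloisRep ℚ ↥(padicCoeffIntegers S) 2)
  (ePk : ∀ k : ℕ, ↥(AddSubgroup.torsionBy (Cofree ρ ↥(padicCoeffField S)) ((2 ^ k : ℕ) : ℤ)) →
    ↥(AddSubgroup.torsionBy (Cofree ρ ↥(padicCoeffField S)) ((2 ^ k : ℕ) : ℤ)) → AlgebraicClosure ℚ)
  (hμPk : ∀ k a b, ePk k a b ^ (2 ^ k) = 1)
  (hadd₁Pk : ∀ k a₁ a₂ b, ePk k (a₁ + a₂) b = ePk k a₁ b * ePk k a₂ b)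
  (hadd₂Pk : ∀ k a b₁ b₂, ePk k a (b₁ + b₂) = ePk k a b₁ * ePk k a b₂)
  (hgalPk : ∀ k (σ : absoluteGaloisGroup ℚ) (a b : ↥(AddSubgroup.torsionBy (Cofree ρ ↥(padicCoeffField S)) ((2 ^ k : ℕ) : ℤ))),
    σ • ePk k a b = ePk k (cofreeTorsionGaloisModule S ρ _ σ a) (cofreeTorsionGaloisModule S ρ _ σ b))
  (hnondeg : ∀ k T, (∀ a, ePk k a T = 1) → T = 0)
  (κ : ZpExtension ℚ 2) (hκ : κ.IsCyclotomic)
  (S₀ : Finset (HeightOneSpectrum (𝓞 ℚ))) (hS₀ : ∀ w ∈ S₀, ((2 : ℕ) : 𝓞 ℚ) ∉ w.asIdeal)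
  (hρ : ∀ w : HeightOneSpectrum (𝓞 ℚ), w ∉ S₀ → ((2 : ℕ) : 𝓞 ℚ) ∉ w.asIdeal → ρ.IsUnramifiedAt w)
  {γ : absoluteGaloisGroup ℚ} (I : IwasawaH1DataCoeff (FramedGaloisRep.toGaloisRep ρ) 2 κ γ)
  (v : HeightOneSpectrum (𝓞 ℚ)) (hv : ((2 : ℕ) : 𝓞 ℚ) ∈ v.asIdeal)
  (χ : PAway S κ ρ S₀)
  (hH : ∀ s : subgroupH1 κ.kerSubgroup (Cofree ρ ↥(padicCoeffField S)), s ∈ selRelSubgroup S κ ρ S₀ → locKer S κ ρ v s = 0 →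
    ∑ w : ↥S₀, ∑ᶠ c : Cosets κ (w : HeightOneSpectrum (𝓞 ℚ)), χ w c (locAway S κ ρ S₀ s w c) = 0)
  (locdS : I.H →+ PAway S κ ρ S₀)
  (hlocdS : ∀ (w : ↥S₀) (c : Cosets κ (w : HeightOneSpectrum (𝓞 ℚ))) (m : ℕ), nfl (w : HeightOneSpectrum (𝓞 ℚ)) ≤ m →
    ∀ (k : ℕ) (x : I.H) (y : Dlev S κ ρ w m k),
    locdS x w c (jAway S κ ρ w m k y) =
      (layerPairingOf (cofreeTorsionGaloisModule S ρ ((2 ^ k : ℕ) : ℤ)) (2 ^ k) (ePk k) (hμPk k) (hadd₁Pk k) (hadd₂Pk k) (hgalPk k) κ w m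
        (reduceH1CofreePkTorsion S ρ k (κ.layerSubgroup m)
          (conjMap (FramedGaloisRep.toGaloisRep ρ).toTopRep (κ.layerSubgroup m) c.out 1 (I.proj m x))) y).val •
        ((((2 : ℚ) ^ k)⁻¹ : ℚ) : AddCircle (1 : ℚ)))
  [instF : ∀ n : ℕ, Fintype (absoluteGaloisGroup ℚ ⧸ κ.layerSubgroup n)]
  [instFin : ∀ k : ℕ, Finite ↥(AddSubgroup.torsionBy (Cofree ρ ↥(padicCoeffField S)) ((2 ^ k : ℕ) : ℤ))]
  -- (T1): the tower compatibility along `[2]` of any character-built local classes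
  (hT1 : ∀ (n k : ℕ) (w : ↥S₀)
    (b₁ : Cosets κ (w : HeightOneSpectrum (𝓞 ℚ)) → Dlev S κ ρ w n (k + 1))
    (t₁ : galoisCohomology
      (((cofreeTorsionGaloisModule S ρ ((2 ^ (k + 1) : ℕ) : ℤ)).coind (κ.layerSubgroup n) (κ.isOpen_layerSubgroup n)).toLocal
        (Sum.inr (w : HeightOneSpectrum (𝓞 ℚ)))) 1)
    (b₀ : Cosets κ (w : HeightOneSpectrum (𝓞 ℚ)) → Dlev S κ ρ w n k)
    (t₀ : galoisCohomology
      (((cofreeTorsionGaloisModule S ρ ((2 ^ k : ℕ) : ℤ)).coind (κ.layerSubgroup n) (κ.isOpen_layerSubgroup n)).toLocal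
        (Sum.inr (w : HeightOneSpectrum (𝓞 ℚ)))) 1),
    (∀ (c : Cosets κ (w : HeightOneSpectrum (𝓞 ℚ))) (y : Dlev S κ ρ w n (k + 1)),
      χ w c (jAway S κ ρ w n (k + 1) y) =
        (layerPairingH1Of (cofreeTorsionGaloisModule S ρ ((2 ^ (k + 1) : ℕ) : ℤ)) (2 ^ (k + 1)) (ePk (k + 1)) (hμPk (k + 1))
            (hadd₁Pk (k + 1)) (hadd₂Pk (k + 1)) (hgalPk (k + 1)) κ w n (b₁ c) y).val • ((((2 : ℚ) ^ (k + 1))⁻¹ : ℚ) : AddCircle (1 : ℚ))) →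
    (∀ c : Cosets κ (w : HeightOneSpectrum (𝓞 ℚ)),
      cohomologyMap (resCoindFinHomR (cofreeTorsionGaloisModule S ρ ((2 ^ (k + 1) : ℕ) : ℤ)).toTopRep (κ.layerSubgroup n)
          (resGalOfEmb (closureEmb (K := ℚ) ((w : HeightOneSpectrum (𝓞 ℚ)).adicCompletion ℚ)))
          (c.out : absoluteGaloisGroup ℚ ⧸ κ.layerSubgroup n)) 1 t₁ =
        layerShapiroOf (cofreeTorsionGaloisModule S ρ ((2 ^ (k + 1) : ℕ) : ℤ)) κ w n (b₁ c)) →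
    (∀ (c : Cosets κ (w : HeightOneSpectrum (𝓞 ℚ))) (y : Dlev S κ ρ w n k),
      χ w c (jAway S κ ρ w n k y) =
        (layerPairingH1Of (cofreeTorsionGaloisModule S ρ ((2 ^ k : ℕ) : ℤ)) (2 ^ k) (ePk k) (hμPk k) (hadd₁Pk k) (hadd₂Pk k) (hgalPk k)
            κ w n (b₀ c) y).val • ((((2 : ℚ) ^ k)⁻¹ : ℚ) : AddCircle (1 : ℚ))) →
    (∀ c : Cosets κ (w : HeightOneSpectrum (𝓞 ℚ)),
      cohomologyMap (resCoindFinHomR (cofreeTorsionGaloisModule S ρ ((2 ^ k : ℕ) : ℤ)).toTopRep (κ.layerSubgroup n)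
          (resGalOfEmb (closureEmb (K := ℚ) ((w : HeightOneSpectrum (𝓞 ℚ)).adicCompletion ℚ)))
          (c.out : absoluteGaloisGroup ℚ ⧸ κ.layerSubgroup n)) 1 t₀ =
        layerShapiroOf (cofreeTorsionGaloisModule S ρ ((2 ^ k : ℕ) : ℤ)) κ w n (b₀ c)) →
    cohomologyMap (TopRep.ofHom ⟨(coindFinMap (cofreeTorsionPow S ρ k) (κ.layerSubgroup n)).hom.toContinuousLinearMap, fun δ =>
        (coindFinMap (cofreeTorsionPow S ρ k) (κ.layerSubgroup n)).hom.isIntertwining'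
          (resGalOfEmb (closureEmb (K := ℚ) ((w : HeightOneSpectrum (𝓞 ℚ)).adicCompletion ℚ)) δ)⟩ :
      (((cofreeTorsionGaloisModule S ρ ((2 ^ (k + 1) : ℕ) : ℤ)).coind (κ.layerSubgroup n) (κ.isOpen_layerSubgroup n)).toLocal
          (Sum.inr (w : HeightOneSpectrum (𝓞 ℚ)))).toTopRep ⟶
        (((cofreeTorsionGaloisModule S ρ ((2 ^ k : ℕ) : ℤ)).coind (κ.layerSubgroup n) (κ.isOpen_layerSubgroup n)).toLocal
          (Sum.inr (w : HeightOneSpectrum (𝓞 ℚ)))).toTopRep) 1 t₁ = t₀)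
  -- (T2): the tower compatibility along Kato's trace of any character-built local classes
  (hT2 : ∀ (n k : ℕ) (w : ↥S₀)
    (b₁ : Cosets κ (w : HeightOneSpectrum (𝓞 ℚ)) → Dlev S κ ρ w (n + 1) k)
    (t₁ : galoisCohomology
      (((cofreeTorsionGaloisModule S ρ ((2 ^ k : ℕ) : ℤ)).coind (κ.layerSubgroup (n + 1)) (κ.isOpen_layerSubgroup (n + 1))).toLocal
        (Sum.inr (w : HeightOneSpectrum (𝓞 ℚ)))) 1)
    (b₀ : Cosets κ (w : HeightOneSpectrum (𝓞 ℚ)) → Dlev S κ ρ w n k)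
    (t₀ : galoisCohomology
      (((cofreeTorsionGaloisModule S ρ ((2 ^ k : ℕ) : ℤ)).coind (κ.layerSubgroup n) (κ.isOpen_layerSubgroup n)).toLocal
        (Sum.inr (w : HeightOneSpectrum (𝓞 ℚ)))) 1),
    (∀ (c : Cosets κ (w : HeightOneSpectrum (𝓞 ℚ))) (y : Dlev S κ ρ w (n + 1) k),
      χ w c (jAway S κ ρ w (n + 1) k y) =
        (layerPairingH1Of (cofreeTorsionGaloisModule S ρ ((2 ^ k : ℕ) : ℤ)) (2 ^ k) (ePk k) (hμPk k) (hadd₁Pk k) (hadd₂Pk k) (hgalPk k)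
            κ w (n + 1) (b₁ c) y).val • ((((2 : ℚ) ^ k)⁻¹ : ℚ) : AddCircle (1 : ℚ))) →
    (∀ c : Cosets κ (w : HeightOneSpectrum (𝓞 ℚ)),
      cohomologyMap (resCoindFinHomR (cofreeTorsionGaloisModule S ρ ((2 ^ k : ℕ) : ℤ)).toTopRep (κ.layerSubgroup (n + 1))
          (resGalOfEmb (closureEmb (K := ℚ) ((w : HeightOneSpectrum (𝓞 ℚ)).adicCompletion ℚ)))
          (c.out : absoluteGaloisGroup ℚ ⧸ κ.layerSubgroup (n + 1))) 1 t₁ =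
        layerShapiroOf (cofreeTorsionGaloisModule S ρ ((2 ^ k : ℕ) : ℤ)) κ w (n + 1) (b₁ c)) →
    (∀ (c : Cosets κ (w : HeightOneSpectrum (𝓞 ℚ))) (y : Dlev S κ ρ w n k),
      χ w c (jAway S κ ρ w n k y) =
        (layerPairingH1Of (cofreeTorsionGaloisModule S ρ ((2 ^ k : ℕ) : ℤ)) (2 ^ k) (ePk k) (hμPk k) (hadd₁Pk k) (hadd₂Pk k) (hgalPk k)
            κ w n (b₀ c) y).val • ((((2 : ℚ) ^ k)⁻¹ : ℚ) : AddCircle (1 : ℚ))) →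
    (∀ c : Cosets κ (w : HeightOneSpectrum (𝓞 ℚ)),
      cohomologyMap (resCoindFinHomR (cofreeTorsionGaloisModule S ρ ((2 ^ k : ℕ) : ℤ)).toTopRep (κ.layerSubgroup n)
          (resGalOfEmb (closureEmb (K := ℚ) ((w : HeightOneSpectrum (𝓞 ℚ)).adicCompletion ℚ)))
          (c.out : absoluteGaloisGroup ℚ ⧸ κ.layerSubgroup n)) 1 t₀ =
        layerShapiroOf (cofreeTorsionGaloisModule S ρ ((2 ^ k : ℕ) : ℤ)) κ w n (b₀ c)) →
    cohomologyMap (TopRep.ofHom ⟨(coindFinSum (cofreeTorsionGaloisModule S ρ ((2 ^ k : ℕ) : ℤ)).toTopRep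
          (κ.layerSubgroup_antitone (Nat.le_succ n))).hom.toContinuousLinearMap, fun δ =>
        (coindFinSum (cofreeTorsionGaloisModule S ρ ((2 ^ k : ℕ) : ℤ)).toTopRep (κ.layerSubgroup_antitone (Nat.le_succ n))).hom.isIntertwining'
          (resGalOfEmb (closureEmb (K := ℚ) ((w : HeightOneSpectrum (𝓞 ℚ)).adicCompletion ℚ)) δ)⟩ :
      (((cofreeTorsionGaloisModule S ρ ((2 ^ k : ℕ) : ℤ)).coind (κ.layerSubgroup (n + 1)) (κ.isOpen_layerSubgroup (n + 1))).toLocal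
          (Sum.inr (w : HeightOneSpectrum (𝓞 ℚ)))).toTopRep ⟶
        (((cofreeTorsionGaloisModule S ρ ((2 ^ k : ℕ) : ℤ)).coind (κ.layerSubgroup n) (κ.isOpen_layerSubgroup n)).toLocal
          (Sum.inr (w : HeightOneSpectrum (𝓞 ℚ)))).toTopRep) 1 t₁ = t₀)

include hnondeg hκ hS₀ hρ hv hH hlocdS hT1 hT2 in
/-- **S4₀ assembled modulo (T1)/(T2).** Under the hypotheses listed in the module docstring there is `x ∈ I.H` with `locdS x = χ` (so the S4₀
text's conclusion holds with `a = 1`). [cite: Kato2004Asterisque, §12.2 (p. 220), §13.8 (p. 228)] [cite: MilneADT2006, Ch. I, Thm. 4.10]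
[cite: PerrinRiou1994Invent, §3.6.1] [cite: GreenbergVatsal2000, §2 Prop. 2.4] -/
theorem exists_iwasawaH1_locdS_eq_of_towerCompat [CompactSpace ↥(padicCoeffIntegers S)] : ∃ x : I.H, locdS x = χ := by
  haveI : CompactSpace (absoluteGaloisGroup ℚ) := absoluteGaloisGroup_compactSpace ℚ
  haveI hcw : ∀ w : HeightOneSpectrum (𝓞 ℚ), CompactSpace (absoluteGaloisGroup (w.adicCompletion ℚ)) :=
    fun w => absoluteGaloisGroup_compactSpace _
  haveI : ∀ w : ↥S₀, Fintype (Cosets κ (w : HeightOneSpectrum (𝓞 ℚ))) := fun w => instF _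
  -- the character-built (α)-family, from the floor `n_w` at each `w ∈ S₀`
  have H := fun (n k : ℕ) (w : ↥S₀) (hn : nfl (w : HeightOneSpectrum (𝓞 ℚ)) ≤ n) =>
    exists_local_of_characters S ρ ePk hμPk hadd₁Pk hadd₂Pk hgalPk hnondeg κ hκ (w : HeightOneSpectrum (𝓞 ℚ)) (hS₀ w w.2) hn k (χ w)
  choose b t hb hu ht using H
  -- total families (junk `0` below the floor / off `S₀`)
  let N₀ : ℕ := S₀.sup fun w => nfl w
  have hN₀ : ∀ w ∈ S₀, nfl w ≤ N₀ := fun w hw => Finset.le_sup (f := fun w => nfl w) hw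
  let bT : ∀ (n k : ℕ) (w : ↥S₀), Cosets κ (w : HeightOneSpectrum (𝓞 ℚ)) → Dlev S κ ρ w n k :=
    fun n k w c => if h : nfl (w : HeightOneSpectrum (𝓞 ℚ)) ≤ n then b n k w h c else 0
  let tT : ∀ (n k : ℕ) (w : ↥S₀), galoisCohomology
      (((cofreeTorsionGaloisModule S ρ ((2 ^ k : ℕ) : ℤ)).coind (κ.layerSubgroup n) (κ.isOpen_layerSubgroup n)).toLocal
        (Sum.inr (w : HeightOneSpectrum (𝓞 ℚ)))) 1 :=
    fun n k w => if h : nfl (w : HeightOneSpectrum (𝓞 ℚ)) ≤ n then t n k w h else 0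
  let tf : ∀ (n k : ℕ) (w : HeightOneSpectrum (𝓞 ℚ)), galoisCohomology
      (((cofreeTorsionGaloisModule S ρ ((2 ^ k : ℕ) : ℤ)).coind (κ.layerSubgroup n) (κ.isOpen_layerSubgroup n)).toLocal (Sum.inr w)) 1 :=
    fun n k w => if h : w ∈ S₀ then tT n k ⟨w, h⟩ else 0
  have hbT : ∀ (n : ℕ) (hn : N₀ ≤ n) (k : ℕ) (w : ↥S₀), bT n k w = b n k w ((hN₀ w w.2).trans hn) := fun n hn k w => by
    simp only [bT, dif_pos ((hN₀ w w.2).trans hn)]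
  have htT : ∀ (n : ℕ) (hn : N₀ ≤ n) (k : ℕ) (w : ↥S₀), tT n k w = t n k w ((hN₀ w w.2).trans hn) := fun n hn k w => by
    simp only [tT, dif_pos ((hN₀ w w.2).trans hn)]
  have htf : ∀ (n k : ℕ) (w : HeightOneSpectrum (𝓞 ℚ)) (hw : w ∈ S₀), tf n k w = tT n k ⟨w, hw⟩ := fun n k w hw => by
    simp only [tf, dif_pos hw]
  -- the socket p697362
  obtain ⟨x, hx⟩ := exists_iwasawaH1_prescribed_of_levelwise_orthogonal S ρ ePk hμPk hadd₁Pk hadd₂Pk hgalPk hnondeg κ hκ S₀ hS₀ hρ I N₀ tf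
    (fun n hn k s hs hs1 c hc w hw => by
      rw [localization_shapiroLift_cofreeTorsionPow, hc w hw, htf n (k + 1) w hw, htf n k w hw, htT n hn (k + 1) ⟨w, hw⟩, htT n hn k ⟨w, hw⟩]
      exact hT1 n k ⟨w, hw⟩ _ _ _ _ (hb n (k + 1) ⟨w, hw⟩ _) (hu n (k + 1) ⟨w, hw⟩ _) (hb n k ⟨w, hw⟩ _) (hu n k ⟨w, hw⟩ _))
    (fun n hn k s hs hs1 s' hs' hs'1 c hc w hw => by
      rw [localization_shapiroLift_layerCores S ρ κ n hs hs1 w hs' hs'1, hc w hw, htf (n + 1) k w hw, htf n k w hw,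
        htT (n + 1) (hn.trans (Nat.le_succ n)) k ⟨w, hw⟩, htT n hn k ⟨w, hw⟩]
      exact hT2 n k ⟨w, hw⟩ _ _ _ _ (hb (n + 1) k ⟨w, hw⟩ _) (hu (n + 1) k ⟨w, hw⟩ _) (hb n k ⟨w, hw⟩ _) (hu n k ⟨w, hw⟩ _))
    (fun n hn k s hs hs1 a hur hinf hp => by
      rw [← Finset.sum_coe_sort]
      rw [Finset.sum_congr rfl fun (w : ↥S₀) _ => by rw [htf n k w w.2, htT n hn k w]]
      exact sum_localTatePairingZMod_eq_zero_of_awayHyp S ρ ePk hμPk hadd₁Pk hadd₂Pk hgalPk κ S₀ hρ v hv χ hH n k hs hs1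
        (fun w c => b n k w ((hN₀ w w.2).trans hn) c) (fun w c y => hb n k w _ c y) a hur hinf hp (fun w => t n k w ((hN₀ w w.2).trans hn))
        (fun w => ht n k w _ hs hs1 a))
  -- the S₀-pin transfer
  refine ⟨x, locdS_eq_of_prescribed S ρ ePk hμPk hadd₁Pk hadd₂Pk hgalPk κ S₀ I x N₀ bT tT
    (fun n hn k w c => by rw [hbT n hn k w, htT n hn k w]; exact hu n k w _ c)
    (fun n k hn s hs hs1 w => by
      have e : tf n k (w : HeightOneSpectrum (𝓞 ℚ)) = tT n k w := by simp only [tf, dif_pos w.2]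
      rw [← e]; exact (hx n k hn).2 hs hs1 w w.2) χ
    (fun n hn k w c y => by rw [hbT n hn k w]; exact hb n k w _ c y) locdS hlocdS⟩

include hnondeg hκ hS₀ hρ hv hH hlocdS in
/-- **S4₀ assembled modulo (T1)/(T2), FLOOR VERSION.** The same conclusion `∃ x : I.H, locdS x = χ` when the tower compatibilities (T1)/(T2) are only
known from the splitting level on (`n_w ≤ n`, which is all the proof above ever uses: the prescribed family starts at the floor `N₀ = max_w n_w`).
This is the form in which (T1)/(T2) are dischargeable from the character hypotheses alone (`…DeepHalfAwayTwoTowerPow`, `…DeepHalfAwayTwoTowerCores`):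
below the splitting level two level-`n+1` orbits merge into one level-`n` orbit and (T2) is not a consequence of them.
[cite: Kato2004Asterisque, §12.2 (p. 220), §13.8 (p. 228)] [cite: MilneADT2006, Ch. I, Thm. 4.10] [cite: PerrinRiou1994Invent, §3.6.1] -/
theorem exists_iwasawaH1_locdS_eq_of_towerCompat_floor [CompactSpace ↥(padicCoeffIntegers S)]
      (hT1' : ∀ (n k : ℕ) (w : ↥S₀), nfl (w : HeightOneSpectrum (𝓞 ℚ)) ≤ n → ∀
      (b₁ : Cosets κ (w : HeightOneSpectrum (𝓞 ℚ)) → Dlev S κ ρ w n (k + 1))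
      (t₁ : galoisCohomology
        (((cofreeTorsionGaloisModule S ρ ((2 ^ (k + 1) : ℕ) : ℤ)).coind (κ.layerSubgroup n) (κ.isOpen_layerSubgroup n)).toLocal
          (Sum.inr (w : HeightOneSpectrum (𝓞 ℚ)))) 1)
      (b₀ : Cosets κ (w : HeightOneSpectrum (𝓞 ℚ)) → Dlev S κ ρ w n k)
      (t₀ : galoisCohomology
        (((cofreeTorsionGaloisModule S ρ ((2 ^ k : ℕ) : ℤ)).coind (κ.layerSubgroup n) (κ.isOpen_layerSubgroup n)).toLocal
          (Sum.inr (w : HeightOneSpectrum (𝓞 ℚ)))) 1),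
      (∀ (c : Cosets κ (w : HeightOneSpectrum (𝓞 ℚ))) (y : Dlev S κ ρ w n (k + 1)),
        χ w c (jAway S κ ρ w n (k + 1) y) =
          (layerPairingH1Of (cofreeTorsionGaloisModule S ρ ((2 ^ (k + 1) : ℕ) : ℤ)) (2 ^ (k + 1)) (ePk (k + 1)) (hμPk (k + 1))
              (hadd₁Pk (k + 1)) (hadd₂Pk (k + 1)) (hgalPk (k + 1)) κ w n (b₁ c) y).val • ((((2 : ℚ) ^ (k + 1))⁻¹ : ℚ) : AddCircle (1 : ℚ))) →
      (∀ c : Cosets κ (w : HeightOneSpectrum (𝓞 ℚ)),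
        cohomologyMap (resCoindFinHomR (cofreeTorsionGaloisModule S ρ ((2 ^ (k + 1) : ℕ) : ℤ)).toTopRep (κ.layerSubgroup n)
            (resGalOfEmb (closureEmb (K := ℚ) ((w : HeightOneSpectrum (𝓞 ℚ)).adicCompletion ℚ)))
            (c.out : absoluteGaloisGroup ℚ ⧸ κ.layerSubgroup n)) 1 t₁ =
          layerShapiroOf (cofreeTorsionGaloisModule S ρ ((2 ^ (k + 1) : ℕ) : ℤ)) κ w n (b₁ c)) →
      (∀ (c : Cosets κ (w : HeightOneSpectrum (𝓞 ℚ))) (y : Dlev S κ ρ w n k),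
        χ w c (jAway S κ ρ w n k y) =
          (layerPairingH1Of (cofreeTorsionGaloisModule S ρ ((2 ^ k : ℕ) : ℤ)) (2 ^ k) (ePk k) (hμPk k) (hadd₁Pk k) (hadd₂Pk k) (hgalPk k)
              κ w n (b₀ c) y).val • ((((2 : ℚ) ^ k)⁻¹ : ℚ) : AddCircle (1 : ℚ))) →
      (∀ c : Cosets κ (w : HeightOneSpectrum (𝓞 ℚ)),
        cohomologyMap (resCoindFinHomR (cofreeTorsionGaloisModule S ρ ((2 ^ k : ℕ) : ℤ)).toTopRep (κ.layerSubgroup n)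
            (resGalOfEmb (closureEmb (K := ℚ) ((w : HeightOneSpectrum (𝓞 ℚ)).adicCompletion ℚ)))
            (c.out : absoluteGaloisGroup ℚ ⧸ κ.layerSubgroup n)) 1 t₀ =
          layerShapiroOf (cofreeTorsionGaloisModule S ρ ((2 ^ k : ℕ) : ℤ)) κ w n (b₀ c)) →
      cohomologyMap (TopRep.ofHom ⟨(coindFinMap (cofreeTorsionPow S ρ k) (κ.layerSubgroup n)).hom.toContinuousLinearMap, fun δ =>
          (coindFinMap (cofreeTorsionPow S ρ k) (κ.layerSubgroup n)).hom.isIntertwining'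
            (resGalOfEmb (closureEmb (K := ℚ) ((w : HeightOneSpectrum (𝓞 ℚ)).adicCompletion ℚ)) δ)⟩ :
        (((cofreeTorsionGaloisModule S ρ ((2 ^ (k + 1) : ℕ) : ℤ)).coind (κ.layerSubgroup n) (κ.isOpen_layerSubgroup n)).toLocal
            (Sum.inr (w : HeightOneSpectrum (𝓞 ℚ)))).toTopRep ⟶
          (((cofreeTorsionGaloisModule S ρ ((2 ^ k : ℕ) : ℤ)).coind (κ.layerSubgroup n) (κ.isOpen_layerSubgroup n)).toLocal
            (Sum.inr (w : HeightOneSpectrum (𝓞 ℚ)))).toTopRep) 1 t₁ = t₀)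
      (hT2' : ∀ (n k : ℕ) (w : ↥S₀), nfl (w : HeightOneSpectrum (𝓞 ℚ)) ≤ n → ∀
      (b₁ : Cosets κ (w : HeightOneSpectrum (𝓞 ℚ)) → Dlev S κ ρ w (n + 1) k)
      (t₁ : galoisCohomology
        (((cofreeTorsionGaloisModule S ρ ((2 ^ k : ℕ) : ℤ)).coind (κ.layerSubgroup (n + 1)) (κ.isOpen_layerSubgroup (n + 1))).toLocal
          (Sum.inr (w : HeightOneSpectrum (𝓞 ℚ)))) 1)
      (b₀ : Cosets κ (w : HeightOneSpectrum (𝓞 ℚ)) → Dlev S κ ρ w n k)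
      (t₀ : galoisCohomology
        (((cofreeTorsionGaloisModule S ρ ((2 ^ k : ℕ) : ℤ)).coind (κ.layerSubgroup n) (κ.isOpen_layerSubgroup n)).toLocal
          (Sum.inr (w : HeightOneSpectrum (𝓞 ℚ)))) 1),
      (∀ (c : Cosets κ (w : HeightOneSpectrum (𝓞 ℚ))) (y : Dlev S κ ρ w (n + 1) k),
        χ w c (jAway S κ ρ w (n + 1) k y) =
          (layerPairingH1Of (cofreeTorsionGaloisModule S ρ ((2 ^ k : ℕ) : ℤ)) (2 ^ k) (ePk k) (hμPk k) (hadd₁Pk k) (hadd₂Pk k) (hgalPk k)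
              κ w (n + 1) (b₁ c) y).val • ((((2 : ℚ) ^ k)⁻¹ : ℚ) : AddCircle (1 : ℚ))) →
      (∀ c : Cosets κ (w : HeightOneSpectrum (𝓞 ℚ)),
        cohomologyMap (resCoindFinHomR (cofreeTorsionGaloisModule S ρ ((2 ^ k : ℕ) : ℤ)).toTopRep (κ.layerSubgroup (n + 1))
            (resGalOfEmb (closureEmb (K := ℚ) ((w : HeightOneSpectrum (𝓞 ℚ)).adicCompletion ℚ)))
            (c.out : absoluteGaloisGroup ℚ ⧸ κ.layerSubgroup (n + 1))) 1 t₁ =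
          layerShapiroOf (cofreeTorsionGaloisModule S ρ ((2 ^ k : ℕ) : ℤ)) κ w (n + 1) (b₁ c)) →
      (∀ (c : Cosets κ (w : HeightOneSpectrum (𝓞 ℚ))) (y : Dlev S κ ρ w n k),
        χ w c (jAway S κ ρ w n k y) =
          (layerPairingH1Of (cofreeTorsionGaloisModule S ρ ((2 ^ k : ℕ) : ℤ)) (2 ^ k) (ePk k) (hμPk k) (hadd₁Pk k) (hadd₂Pk k) (hgalPk k)
              κ w n (b₀ c) y).val • ((((2 : ℚ) ^ k)⁻¹ : ℚ) : AddCircle (1 : ℚ))) →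
      (∀ c : Cosets κ (w : HeightOneSpectrum (𝓞 ℚ)),
        cohomologyMap (resCoindFinHomR (cofreeTorsionGaloisModule S ρ ((2 ^ k : ℕ) : ℤ)).toTopRep (κ.layerSubgroup n)
            (resGalOfEmb (closureEmb (K := ℚ) ((w : HeightOneSpectrum (𝓞 ℚ)).adicCompletion ℚ)))
            (c.out : absoluteGaloisGroup ℚ ⧸ κ.layerSubgroup n)) 1 t₀ =
          layerShapiroOf (cofreeTorsionGaloisModule S ρ ((2 ^ k : ℕ) : ℤ)) κ w n (b₀ c)) →
      cohomologyMap (TopRep.ofHom ⟨(coindFinSum (cofreeTorsionGaloisModule S ρ ((2 ^ k : ℕ) : ℤ)).toTopRep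
            (κ.layerSubgroup_antitone (Nat.le_succ n))).hom.toContinuousLinearMap, fun δ =>
          (coindFinSum (cofreeTorsionGaloisModule S ρ ((2 ^ k : ℕ) : ℤ)).toTopRep (κ.layerSubgroup_antitone (Nat.le_succ n))).hom.isIntertwining'
            (resGalOfEmb (closureEmb (K := ℚ) ((w : HeightOneSpectrum (𝓞 ℚ)).adicCompletion ℚ)) δ)⟩ :
        (((cofreeTorsionGaloisModule S ρ ((2 ^ k : ℕ) : ℤ)).coind (κ.layerSubgroup (n + 1)) (κ.isOpen_layerSubgroup (n + 1))).toLocal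
            (Sum.inr (w : HeightOneSpectrum (𝓞 ℚ)))).toTopRep ⟶
          (((cofreeTorsionGaloisModule S ρ ((2 ^ k : ℕ) : ℤ)).coind (κ.layerSubgroup n) (κ.isOpen_layerSubgroup n)).toLocal
            (Sum.inr (w : HeightOneSpectrum (𝓞 ℚ)))).toTopRep) 1 t₁ = t₀) :
    ∃ x : I.H, locdS x = χ := by
  haveI : CompactSpace (absoluteGaloisGroup ℚ) := absoluteGaloisGroup_compactSpace ℚ
  haveI hcw : ∀ w : HeightOneSpectrum (𝓞 ℚ), CompactSpace (absoluteGaloisGroup (w.adicCompletion ℚ)) :=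
    fun w => absoluteGaloisGroup_compactSpace _
  haveI : ∀ w : ↥S₀, Fintype (Cosets κ (w : HeightOneSpectrum (𝓞 ℚ))) := fun w => instF _
  -- the character-built (α)-family, from the floor `n_w` at each `w ∈ S₀`
  have H := fun (n k : ℕ) (w : ↥S₀) (hn : nfl (w : HeightOneSpectrum (𝓞 ℚ)) ≤ n) =>
    exists_local_of_characters S ρ ePk hμPk hadd₁Pk hadd₂Pk hgalPk hnondeg κ hκ (w : HeightOneSpectrum (𝓞 ℚ)) (hS₀ w w.2) hn k (χ w)
  choose b t hb hu ht using H
  -- total families (junk `0` below the floor / off `S₀`)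
  let N₀ : ℕ := S₀.sup fun w => nfl w
  have hN₀ : ∀ w ∈ S₀, nfl w ≤ N₀ := fun w hw => Finset.le_sup (f := fun w => nfl w) hw
  let bT : ∀ (n k : ℕ) (w : ↥S₀), Cosets κ (w : HeightOneSpectrum (𝓞 ℚ)) → Dlev S κ ρ w n k :=
    fun n k w c => if h : nfl (w : HeightOneSpectrum (𝓞 ℚ)) ≤ n then b n k w h c else 0
  let tT : ∀ (n k : ℕ) (w : ↥S₀), galoisCohomology
      (((cofreeTorsionGaloisModule S ρ ((2 ^ k : ℕ) : ℤ)).coind (κ.layerSubgroup n) (κ.isOpen_layerSubgroup n)).toLocal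
        (Sum.inr (w : HeightOneSpectrum (𝓞 ℚ)))) 1 :=
    fun n k w => if h : nfl (w : HeightOneSpectrum (𝓞 ℚ)) ≤ n then t n k w h else 0
  let tf : ∀ (n k : ℕ) (w : HeightOneSpectrum (𝓞 ℚ)), galoisCohomology
      (((cofreeTorsionGaloisModule S ρ ((2 ^ k : ℕ) : ℤ)).coind (κ.layerSubgroup n) (κ.isOpen_layerSubgroup n)).toLocal (Sum.inr w)) 1 :=
    fun n k w => if h : w ∈ S₀ then tT n k ⟨w, h⟩ else 0
  have hbT : ∀ (n : ℕ) (hn : N₀ ≤ n) (k : ℕ) (w : ↥S₀), bT n k w = b n k w ((hN₀ w w.2).trans hn) := fun n hn k w => by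
    simp only [bT, dif_pos ((hN₀ w w.2).trans hn)]
  have htT : ∀ (n : ℕ) (hn : N₀ ≤ n) (k : ℕ) (w : ↥S₀), tT n k w = t n k w ((hN₀ w w.2).trans hn) := fun n hn k w => by
    simp only [tT, dif_pos ((hN₀ w w.2).trans hn)]
  have htf : ∀ (n k : ℕ) (w : HeightOneSpectrum (𝓞 ℚ)) (hw : w ∈ S₀), tf n k w = tT n k ⟨w, hw⟩ := fun n k w hw => by
    simp only [tf, dif_pos hw]
  -- the socket p697362
  obtain ⟨x, hx⟩ := exists_iwasawaH1_prescribed_of_levelwise_orthogonal S ρ ePk hμPk hadd₁Pk hadd₂Pk hgalPk hnondeg κ hκ S₀ hS₀ hρ I N₀ tf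
    (fun n hn k s hs hs1 c hc w hw => by
      rw [localization_shapiroLift_cofreeTorsionPow, hc w hw, htf n (k + 1) w hw, htf n k w hw, htT n hn (k + 1) ⟨w, hw⟩, htT n hn k ⟨w, hw⟩]
      exact hT1' n k ⟨w, hw⟩ ((hN₀ w hw).trans hn) _ _ _ _ (hb n (k + 1) ⟨w, hw⟩ _) (hu n (k + 1) ⟨w, hw⟩ _) (hb n k ⟨w, hw⟩ _) (hu n k ⟨w, hw⟩ _))
    (fun n hn k s hs hs1 s' hs' hs'1 c hc w hw => by
      rw [localization_shapiroLift_layerCores S ρ κ n hs hs1 w hs' hs'1, hc w hw, htf (n + 1) k w hw, htf n k w hw,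
        htT (n + 1) (hn.trans (Nat.le_succ n)) k ⟨w, hw⟩, htT n hn k ⟨w, hw⟩]
      exact hT2' n k ⟨w, hw⟩ ((hN₀ w hw).trans hn) _ _ _ _ (hb (n + 1) k ⟨w, hw⟩ _) (hu (n + 1) k ⟨w, hw⟩ _) (hb n k ⟨w, hw⟩ _) (hu n k ⟨w, hw⟩ _))
    (fun n hn k s hs hs1 a hur hinf hp => by
      rw [← Finset.sum_coe_sort]
      rw [Finset.sum_congr rfl fun (w : ↥S₀) _ => by rw [htf n k w w.2, htT n hn k w]]
      exact sum_localTatePairingZMod_eq_zero_of_awayHyp S ρ ePk hμPk hadd₁Pk hadd₂Pk hgalPk κ S₀ hρ v hv χ hH n k hs hs1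
        (fun w c => b n k w ((hN₀ w w.2).trans hn) c) (fun w c y => hb n k w _ c y) a hur hinf hp (fun w => t n k w ((hN₀ w w.2).trans hn))
        (fun w => ht n k w _ hs hs1 a))
  -- the S₀-pin transfer
  refine ⟨x, locdS_eq_of_prescribed S ρ ePk hμPk hadd₁Pk hadd₂Pk hgalPk κ S₀ I x N₀ bT tT
    (fun n hn k w c => by rw [hbT n hn k w, htT n hn k w]; exact hu n k w _ c)
    (fun n k hn s hs hs1 w => by
      have e : tf n k (w : HeightOneSpectrum (𝓞 ℚ)) = tT n k w := by simp only [tf, dif_pos w.2]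
      rw [← e]; exact (hx n k hn).2 hs hs1 w w.2) χ
    (fun n hn k w c y => by rw [hbT n hn k w]; exact hb n k w _ c y) locdS hlocdS⟩

end ThetaTransport.AwayAssembly

end Summit.BirchSwinnertonDyer.BirchSwinnertonDyer.Theorems

end
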